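import Summits.BirchSwinnertonDyer.BirchSwinnertonDyer.Theorems.SignedLowerHalvesSmallImageLowerHalfBothSignsRttCharRoadE1KRigidity
import HarnessLib

/-!
# Route `SignedLowerHalves`, crux L `SmallImageLowerHalfBothSigns` (stmt-BirchSwinnertonDyer-23599), line `rtt_w3` v12 — glue INPUT (I5) `hsS`, step 1: THE RESIDUE
# EMBEDDING `emb : k →+* k'` attached to a faithful unital ring action realising `k` (the formal `𝒪_{K_v}`-module on `W_K[p]`, honda p768833, through
# `ιr = r ∘ ι_v : 𝒪[K_v] → 𝒪_S → 𝒪_S/𝔪_S`, honda p768892): `emb z = ιr b` whenever `u b` has coordinate matrix `z` — the map through which E1-a's character `χ`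
# (`residualChar_eq_or_eq_conj`, p763602) is instantiated in the next file.

Width seat `bsd-line-slh-p3-w3` g18 under LEAD `cruxlead-stmt-BirchSwinnertonDyer-23599` (cell `bsd-ssimc`; `--supports stmt-BirchSwinnertonDyer-23599 --as helper`).
THEOREMS ONLY (no definition, no named fact, no instance, no `sorry`; `emb` is produced by `∃`). Abstract setting: `V` with a frame `e : V ≃+ 𝔽_p²`, `k ⊆ M₂(𝔽_p)` a field
of degree `2`, `u : R → (V →+ V)` a unital ring action (pointwise laws) commuting with a map `φ₀` of non-scalar matrix `g₀ ∈ k` and with a non-scalar member, FAITHFUL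
modulo `p` (`u d = 0 ⇒ d ∈ pR`), and `ιr : R →+* k'` killing `p`. BSD / crux L / INJ_top are NOT proved here.

* `sub_apply_eq` — `u (a - b) Q = u a Q - u b Q`.
* ★★ `exists_residueEmbedding` — `∃ emb : k →+* k', ∀ z b, (∀ Q, e (u b Q) = z *ᵥ e Q) → emb z = ιr b`.

References: [Serre1972] §2.1–2.2; [SerreLocalFields1979] IV §1; [LubinTate1965] §1.
-/

set_option autoImplicit false
set_option linter.dupNamespace false -- D-0017: single-problem summit, the namespace repeats the problem name by design
noncomputable section

open scoped Classical MatrixGroups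

namespace Summit.BirchSwinnertonDyer.BirchSwinnertonDyer.Theorems.SmallImageCharSignedSelmer

open Literature.NumberTheory.GaloisRepresentations Literature.NumberTheory.GaloisRepresentations.Serre1972 Matrix

section Residue

variable {p : ℕ} [Fact p.Prime] {V : Type*} [AddCommGroup V]
  (k : Subalgebra (ZMod p) (Matrix (Fin 2) (Fin 2) (ZMod p))) (e : V ≃+ (Fin 2 → ZMod p))
  {R : Type*} [CommRing R] (u : R → (V →+ V))

/-- A pointwise-additive family is subtractive: `u (a - b) Q = u a Q - u b Q`. [folklore] -/
theorem sub_apply_eq (hadd : ∀ (a b : R) (Q : V), u (a + b) Q = u a Q + u b Q) (a b : R) (Q : V) :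
    u (a - b) Q = u a Q - u b Q := by
  have h := hadd (a - b) b Q
  rw [sub_add_cancel] at h
  rw [h, add_sub_cancel_right]

/-- ★★ **The residue embedding.** For `u : R → End(V)` a unital ring action with pointwise laws commuting with `φ₀` (non-scalar matrix `g₀ ∈ k`), with a
non-scalar member `u r₀`, FAITHFUL modulo `p` (`(∀ Q, u d Q = 0) ⇒ d ∈ pR`), and `ιr : R →+* k'` with `ιr p = 0`: there is a ring homomorphism
`emb : k →+* k'` with `emb z = ιr b` whenever `u b` has coordinate matrix `z` (every `z ∈ k` is so realised, p768610). [cite: Serre1972, §2.2] -/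
theorem exists_residueEmbedding (h2 : Module.finrank (ZMod p) k = 2)
    {g₀ : Matrix (Fin 2) (Fin 2) (ZMod p)} (hg₀ : g₀ ∈ k) (hg₀s : ∀ c : ZMod p, g₀ ≠ c • 1)
    (φ₀ : V → V) (hφ₀ : ∀ x : V, e (φ₀ x) = g₀ *ᵥ e x)
    (hadd : ∀ (a b : R) (Q : V), u (a + b) Q = u a Q + u b Q)
    (hmul : ∀ (a b : R) (Q : V), u (a * b) Q = u a (u b Q)) (hone : ∀ Q : V, u 1 Q = Q)
    (hcomm : ∀ (r : R) (Q : V), u r (φ₀ Q) = φ₀ (u r Q))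
    {r₀ : R} (hr₀ : ∀ c : ZMod p, ∃ Q : V, e (u r₀ Q) ≠ c • e Q)
    (hfaith : ∀ d : R, (∀ Q : V, u d Q = 0) → ∃ d' : R, d = (p : R) * d')
    {k' : Type*} [CommRing k'] (ιr : R →+* k') (hιrp : ιr (p : R) = 0) :
    ∃ emb : k →+* k', ∀ (z : k) (b : R), (∀ Q : V, e (u b Q) = (z : Matrix (Fin 2) (Fin 2) (ZMod p)) *ᵥ e Q) → emb z = ιr b := by
  -- a realisation `b z` of every `z ∈ k`
  have hreal : ∀ z : k, ∃ b : R, ∀ Q : V, e (u b Q) = (z : Matrix (Fin 2) (Fin 2) (ZMod p)) *ᵥ e Q := fun z ↦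
    forall_mem_exists_forall_eq_mulVec k e h2 hg₀ hg₀s φ₀ hφ₀ u hadd hmul hone hcomm hr₀ z z.2
  choose b hb using hreal
  -- two realisations of the same matrix agree modulo `p`, hence have the same image under `ιr`
  have hwd : ∀ (z : k) (b' : R), (∀ Q : V, e (u b' Q) = (z : Matrix (Fin 2) (Fin 2) (ZMod p)) *ᵥ e Q) → ιr (b z) = ιr b' := by
    intro z b' hb'
    have h0 : ∀ Q : V, u (b z - b') Q = 0 := fun Q ↦ by
      rw [sub_apply_eq u hadd]
      apply e.injective
      rw [map_sub, hb, hb', sub_self, map_zero]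
    obtain ⟨d', hd'⟩ := hfaith _ h0
    rw [← sub_eq_zero, ← map_sub, hd', map_mul, hιrp, zero_mul]
  -- matrices of `u 1`, `u (a*b)`, `u (a+b)`
  have hb1 : ∀ Q : V, e (u 1 Q) = ((1 : k) : Matrix (Fin 2) (Fin 2) (ZMod p)) *ᵥ e Q := fun Q ↦ by
    rw [hone, OneMemClass.coe_one, Matrix.one_mulVec]
  have hbmul : ∀ (z z' : k) (Q : V), e (u (b z * b z') Q) = ((z * z' : k) : Matrix (Fin 2) (Fin 2) (ZMod p)) *ᵥ e Q := fun z z' Q ↦ by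
    rw [hmul, hb, hb, Matrix.mulVec_mulVec, MulMemClass.coe_mul]
  have hbadd : ∀ (z z' : k) (Q : V), e (u (b z + b z') Q) = ((z + z' : k) : Matrix (Fin 2) (Fin 2) (ZMod p)) *ᵥ e Q := fun z z' Q ↦ by
    rw [hadd, map_add, hb, hb, AddMemClass.coe_add, Matrix.add_mulVec]
  have hb0 : ∀ Q : V, e (u 0 Q) = ((0 : k) : Matrix (Fin 2) (Fin 2) (ZMod p)) *ᵥ e Q := fun Q ↦ by
    have h := hadd 0 0 Q
    rw [add_zero] at h
    have h' : u 0 Q = 0 := by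
      have := h; nth_rewrite 1 [← add_zero (u 0 Q)] at this; exact (add_left_cancel this).symm
    rw [h', map_zero, ZeroMemClass.coe_zero, Matrix.zero_mulVec]
  let emb : k →+* k' :=
    { toFun := fun z ↦ ιr (b z),
      map_one' := (hwd 1 1 hb1).trans (map_one ιr),
      map_mul' := fun z z' ↦ by
        change ιr (b (z * z')) = ιr (b z) * ιr (b z')
        rw [hwd (z * z') (b z * b z') (hbmul z z'), map_mul],
      map_zero' := (hwd 0 0 hb0).trans (map_zero ιr),
      map_add' := fun z z' ↦ by
        change ιr (b (z + z')) = ιr (b z) + ιr (b z')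
        rw [hwd (z + z') (b z + b z') (hbadd z z'), map_add] }
  exact ⟨emb, fun z b' hb' ↦ hwd z b' hb'⟩

end Residue

end Summit.BirchSwinnertonDyer.BirchSwinnertonDyer.Theorems.SmallImageCharSignedSelmer

end
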